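import Summits.HubbardSuperconductivity.HubbardSuperconductivity.Theorems.AnisotropyChordTransferFibre3TwoHoleBSChannel
import Summits.HubbardSuperconductivity.HubbardSuperconductivity.Theorems.AnisotropyChordTransferFibre3TwoChannelReduction

/-!
# Route `AnisotropyChord` / H0 rotor rung: PROP BS in PartN40's own indexing — `A = fromBlocks A₀ M M A₀` (Hankel coupling) and the HOLE₂ certificate of a pair from its EVEN and ODD CHANNELS

Seventh file of PROP BS (memo ROTOR-THEORY-21 §318(g),(h), §324, §327; theory seat `hubbard-h0-rotor-theory-1`).  PartN40
(`…Fibre3TwoChannel`, `…Fibre3TwoChannelReduction`: `twoChannelReduction_holds`) indexes the second cluster of a pair through the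
POINT REFLECTION `p ↦ d − p`, so that the pair's kernel matrix is `fromBlocks A₀ M M A₀` with the symmetric Hankel coupling
`M_{pq} = a_L(p + q − d)`; `…Fibre3TwoHoleBSChannel` indexed it by translation (`z₂ + e`).  This file reconciles the two and pushes
PartN40's two-channel theorem through to a certificate:
* `rho4`/`rho5`/`sig10`/`sig8` — the relabelling `e ↦ −e` of the second cluster; `kerMat_submatrix_sig10`:
  `kerMat ∘ σ = fromBlocks (clusterKer) (hankel d) (hankel d) (clusterKer)` with `clusterKer_{ij} = a_L(e_i − e_j)`,
  `hankel d_{ij} = a_L(e_i + e_j − d)` (`d = z₂ − z₁`; both symmetric: `clusterKer_isSymm`, `hankel_isSymm`);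
* `xvec2_submatrix`, `svec2_submatrix`, `twoHoleP_submatrix_sig10`, `quad_nonneg_submatrix` — relabelling invariance of PartN40's
  objects; ★ `dualCert_of_hankel`: invertible `fromBlocks A₀ M M A₀`, `Λ̃s ≠ 1`, `twoHoleP (fromBlocks A₀ M M A₀) Λ̃ ⪰ 0` ⇒ `DualCert`;
* ★ `twoHoleP_nonneg_of_channels`: by `twoChannelReduction_holds` (`Wᵀ P W = 2(P₊ ⊕ P₋)`, `W² = 2`), positivity of the EVEN channel
  `P₊ = oneHoleP (A₀ + M) (2Λ̃)` and of the ODD channel `P₋ = oneHoleP (A₀ − M) 0` gives `twoHoleP ⪰ 0`;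
* ★★ `dualCert_of_channels`: HOLE₂ certificate of the pair `(z₁, z₂)` from the two one-hole channel problems — THEOREM H2F's
  structure (§318) as a sufficient condition for `TwoHoleGap` (with `twoHoleGap_of_dualCert`); the channel positivity is where
  `oneHoleSkeleton_holds`, `compressionBound_holds`, `capacityShift_of_isSymm` and the torus-difference bounds enter.
Prover seat `hubbard-h0-rotor-p2` g2; helper for stmt-HubbardSuperconductivity-19089 (`--supports`, helper class).
WHAT THIS IS NOT: nothing here proves superconductivity in the Hubbard model; the rotor TARGET as originally worded stays
FALSE (g15 verdict).  Finite matrix algebra behind ONE input (HOLE₂) of ONE conditional reduction (rung 19089); it certifies no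
pair by itself.  Mathlib + tree imports only; no sorry, no axioms.
-/

set_option linter.dupNamespace false

noncomputable section

open scoped BigOperators
open Complex Finset

namespace Summit.HubbardSuperconductivity.HubbardSuperconductivity.Theorems.AnisotropyChord.Transfer.Fibre3

namespace TwoHoleBS

variable (L : ℕ) [NeZero L]

/-! ## PartN40's point-reflected indexing: `A = fromBlocks A₀ M M A₀` with the HANKEL coupling, and the two channels -/

/-- the boundary relabelling `e ↦ −e`: swaps `+eₓ ↔ −eₓ`, `+e_y ↔ −e_y` (indices `0↔1`, `2↔3` of `Fin 4`). [folklore] -/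
def rho4 : Equiv.Perm (Fin 4) := Equiv.swap 0 1 * Equiv.swap 2 3

/-- the cluster relabelling: centre fixed, boundary by `rho4` (indices `1↔2`, `3↔4` of `Fin 5`). [folklore] -/
def rho5 : Equiv.Perm (Fin 5) := Equiv.swap 1 2 * Equiv.swap 3 4

/-- the ten-slot relabelling: identity on the first cluster, `rho5` on the second. [folklore] -/
def sig10 : Equiv.Perm (Fin 5 ⊕ Fin 5) := Equiv.sumCongr (Equiv.refl (Fin 5)) rho5

/-- the eight-slot (boundary) relabelling. [folklore] -/
def sig8 : Equiv.Perm (Fin 4 ⊕ Fin 4) := Equiv.sumCongr (Equiv.refl (Fin 4)) rho4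

omit [NeZero L] in
/-- `rho5` is an involution. [folklore] -/
theorem rho5_rho5 (i : Fin 5) : rho5 (rho5 i) = i := by
  revert i; decide

omit [NeZero L] in
/-- `rho5 ∘ succ = succ ∘ rho4`. [folklore] -/
theorem rho5_succ (j : Fin 4) : rho5 j.succ = (rho4 j).succ := by
  revert j; decide

omit [NeZero L] in
/-- `sig10` is an involution. [folklore] -/
theorem sig10_sig10 (p : Fin 5 ⊕ Fin 5) : sig10 (sig10 p) = p := by
  rcases p with p | p <;> simp [sig10, rho5_rho5]

omit [NeZero L] in
/-- `sig10 ∘ emb = emb ∘ sig8`. [folklore] -/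
theorem sig10_emb (i : Fin 4 ⊕ Fin 4) : sig10 (TwoChannel.emb i) = TwoChannel.emb (sig8 i) := by
  rcases i with i | i <;> simp [sig10, sig8, TwoChannel.emb, rho5_succ]

omit [NeZero L] in
/-- the reflected cluster point: `clusterPt z (rho5 i) = z − clusterPt 0 i`. [folklore] -/
theorem clusterPt_rho5 (z : Tor L) (i : Fin 5) : clusterPt L z (rho5 i) = z - clusterPt L 0 i := by
  fin_cases i <;> simp [clusterPt, rho5, Equiv.swap_apply_def, sub_eq_add_neg]

omit [NeZero L] in
/-- `clusterPt z i = z + clusterPt 0 i`. [folklore] -/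
theorem clusterPt_eq_add (z : Tor L) (i : Fin 5) : clusterPt L z i = z + clusterPt L 0 i := by
  fin_cases i <;> simp [clusterPt]

/-- the one-hole cluster kernel `A₀_{ij} = a_L(e_i − e_j)` (`e_0 = 0`). [folklore] -/
def clusterKer (g : ℝ) : Matrix (Fin 5) (Fin 5) ℝ :=
  Matrix.of fun i j => 2 * aKer L (2 * g) (clusterPt L 0 i - clusterPt L 0 j)

/-- the HANKEL coupling of a pair at separation `d`: `M_{ij} = a_L(e_i + e_j − d)` (`= a_L(d − e_i − e_j)`). [folklore] -/
def hankel (g : ℝ) (d : Tor L) : Matrix (Fin 5) (Fin 5) ℝ :=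
  Matrix.of fun i j => 2 * aKer L (2 * g) (clusterPt L 0 i + clusterPt L 0 j - d)

/-- `a_L` is even (walk units). [folklore] -/
theorem two_aKer_neg (g : ℝ) (r : Tor L) : 2 * aKer L (2 * g) (-r) = 2 * aKer L (2 * g) r := by
  unfold aKer; rw [Gres_neg]

/-- ★ **PartN40's block form:** relabelling the second cluster by the point reflection, the kernel matrix of the pair
`(z₁, z₂)` is `fromBlocks A₀ M M A₀` with `A₀ = clusterKer` and the Hankel coupling `M = hankel (z₂ − z₁)`. [folklore] -/
theorem kerMat_submatrix_sig10 (g : ℝ) (z₁ z₂ : Tor L) :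
    (kerMat L g z₁ z₂).submatrix sig10 sig10
      = Matrix.fromBlocks (clusterKer L g) (hankel L g (z₂ - z₁)) (hankel L g (z₂ - z₁)) (clusterKer L g) := by
  ext p q
  rcases p with i | i <;> rcases q with j | j <;>
    simp only [Matrix.submatrix_apply, kerMat, Matrix.of_apply, Matrix.fromBlocks_apply₁₁, Matrix.fromBlocks_apply₁₂,
      Matrix.fromBlocks_apply₂₁, Matrix.fromBlocks_apply₂₂, sig10, Equiv.sumCongr_apply, Sum.map_inl, Sum.map_inr,
      Equiv.coe_refl, id_eq, bsPt, Sum.elim_inl, Sum.elim_inr, clusterKer, hankel, clusterPt_rho5]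
  · rw [clusterPt_eq_add L z₁ i, clusterPt_eq_add L z₁ j]; congr 1; abel
  · rw [clusterPt_eq_add L z₁ i]; congr 1; abel
  · rw [clusterPt_eq_add L z₁ j, ← two_aKer_neg]; congr 1; abel
  · rw [← two_aKer_neg]; congr 1; abel

/-- `clusterKer` is symmetric. [folklore] -/
theorem clusterKer_isSymm (g : ℝ) : (clusterKer L g).IsSymm := by
  ext i j
  simp only [clusterKer, Matrix.transpose_apply, Matrix.of_apply]
  rw [← two_aKer_neg]; congr 1; abel

/-- `hankel` is symmetric. [folklore] -/
theorem hankel_isSymm (g : ℝ) (d : Tor L) : (hankel L g d).IsSymm := by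
  ext i j
  simp only [hankel, Matrix.transpose_apply, Matrix.of_apply]
  congr 1; abel

/-- harmonic-measure vectors under a simultaneous relabelling. [folklore] -/
theorem xvec2_submatrix (A : Matrix (Fin 5 ⊕ Fin 5) (Fin 5 ⊕ Fin 5) ℝ) (σ : Equiv.Perm (Fin 5 ⊕ Fin 5)) (p : Fin 5 ⊕ Fin 5) :
    TwoChannel.xvec2 (A.submatrix σ σ) p = TwoChannel.xvec2 A (σ p) := by
  unfold TwoChannel.xvec2
  rw [Matrix.inv_submatrix_equiv, Matrix.submatrix_mulVec_equiv]
  simp only [Function.comp_apply]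
  congr 1

/-- `s` is invariant under relabelling. [folklore] -/
theorem svec2_submatrix (A : Matrix (Fin 5 ⊕ Fin 5) (Fin 5 ⊕ Fin 5) ℝ) (σ : Equiv.Perm (Fin 5 ⊕ Fin 5)) :
    TwoChannel.svec2 (A.submatrix σ σ) = TwoChannel.svec2 A := by
  unfold TwoChannel.svec2
  simp_rw [xvec2_submatrix]
  exact Equiv.sum_comp σ (TwoChannel.xvec2 A)

/-- the two-hole map under the cluster relabelling `sig10`: `twoHoleP (A∘σ) Λ = (twoHoleP A Λ)∘σ'` on the boundary. [folklore] -/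
theorem twoHoleP_submatrix_sig10 (A : Matrix (Fin 5 ⊕ Fin 5) (Fin 5 ⊕ Fin 5) ℝ) (Λ : ℝ) :
    TwoChannel.twoHoleP (A.submatrix sig10 sig10) Λ = (TwoChannel.twoHoleP A Λ).submatrix sig8 sig8 := by
  ext i j
  simp only [TwoChannel.twoHoleP, Matrix.of_apply, Matrix.submatrix_apply, xvec2_submatrix, svec2_submatrix,
    Matrix.inv_submatrix_equiv, sig10_emb]
  congr 1
  by_cases h : i = j
  · subst h; simp
  · rw [if_neg h, if_neg (fun h' => h (sig8.injective h'))]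

/-- positivity of a real quadratic form is invariant under relabelling. [folklore] -/
theorem quad_nonneg_submatrix {P : Matrix (Fin 4 ⊕ Fin 4) (Fin 4 ⊕ Fin 4) ℝ} (σ : Equiv.Perm (Fin 4 ⊕ Fin 4))
    (h : ∀ v : Fin 4 ⊕ Fin 4 → ℝ, 0 ≤ dotProduct v (P.mulVec v)) (v : Fin 4 ⊕ Fin 4 → ℝ) :
    0 ≤ dotProduct v ((P.submatrix σ σ).mulVec v) := by
  rw [Matrix.submatrix_mulVec_equiv, ← comp_equiv_symm_dotProduct]
  exact h (v ∘ σ.symm)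

/-- ★ **HOLE₂ certificate from PartN40 data in PartN40's own indexing:** if `A = fromBlocks A₀ M M A₀` (cluster kernel and Hankel
coupling of the pair) is invertible, `Λ̃ s ≠ 1`, and `twoHoleP A Λ̃ ⪰ 0`, then the pair is certified. [folklore] -/
theorem dualCert_of_hankel (g : ℝ) (z₁ z₂ : Tor L)
    (hA : IsUnit (Matrix.fromBlocks (clusterKer L g) (hankel L g (z₂ - z₁)) (hankel L g (z₂ - z₁)) (clusterKer L g)).det)
    (hΛ : capT L g * TwoChannel.svec2
      (Matrix.fromBlocks (clusterKer L g) (hankel L g (z₂ - z₁)) (hankel L g (z₂ - z₁)) (clusterKer L g)) - 1 ≠ 0)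
    (hP : ∀ v : Fin 4 ⊕ Fin 4 → ℝ, 0 ≤ dotProduct v ((TwoChannel.twoHoleP
      (Matrix.fromBlocks (clusterKer L g) (hankel L g (z₂ - z₁)) (hankel L g (z₂ - z₁)) (clusterKer L g))
      (capT L g)).mulVec v)) :
    DualCert L g z₁ z₂ := by
  have hK : kerMat L g z₁ z₂
      = (Matrix.fromBlocks (clusterKer L g) (hankel L g (z₂ - z₁)) (hankel L g (z₂ - z₁)) (clusterKer L g)).submatrix
          sig10 sig10 := by
    rw [← kerMat_submatrix_sig10]
    ext p q
    simp only [Matrix.submatrix_apply, sig10_sig10]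
  refine dualCert_of_twoHoleP L g z₁ z₂ ?_ ?_ ?_
  · rw [hK, Matrix.det_submatrix_equiv_self]; exact hA
  · rw [hK, svec2_submatrix]; exact hΛ
  · intro v
    rw [hK, twoHoleP_submatrix_sig10]
    exact quad_nonneg_submatrix sig8 hP v

/-- positivity of the two-hole map from positivity of the two CHANNELS (`Wᵀ P W = 2(P₊ ⊕ P₋)`, `W² = 2`). [folklore] -/
theorem twoHoleP_nonneg_of_channels (A₀ M : Matrix (Fin 5) (Fin 5) ℝ) (Λ : ℝ)
    (hA : A₀.IsSymm) (hM : M.IsSymm) (hp : IsUnit (A₀ + M).det) (hm : IsUnit (A₀ - M).det)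
    (hs : Λ * TwoChannel.svec2 (Matrix.fromBlocks A₀ M M A₀) - 1 ≠ 0)
    (hplus : ∀ u : Fin 4 → ℝ, 0 ≤ dotProduct u ((TwoChannel.oneHoleP (A₀ + M) (2 * Λ)).mulVec u))
    (hminus : ∀ u : Fin 4 → ℝ, 0 ≤ dotProduct u ((TwoChannel.oneHoleP (A₀ - M) 0).mulVec u))
    (v : Fin 4 ⊕ Fin 4 → ℝ) :
    0 ≤ dotProduct v ((TwoChannel.twoHoleP (Matrix.fromBlocks A₀ M M A₀) Λ).mulVec v) := by
  have hred := TwoChannel.twoChannelReduction_holds A₀ M Λ hA hM hp hm hs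
  set P := TwoChannel.twoHoleP (Matrix.fromBlocks A₀ M M A₀) Λ with hPdef
  set Pp := TwoChannel.oneHoleP (A₀ + M) (2 * Λ) with hPp
  set Pm := TwoChannel.oneHoleP (A₀ - M) 0 with hPm
  have hWT : TwoChannel.W.transpose = TwoChannel.W := by
    unfold TwoChannel.W
    rw [Matrix.fromBlocks_transpose]
    simp
  have hWW : TwoChannel.W * TwoChannel.W = (2 : ℝ) • (1 : Matrix (Fin 4 ⊕ Fin 4) (Fin 4 ⊕ Fin 4) ℝ) := by
    have h := TwoChannel.W_transpose_mul_W
    rwa [hWT] at h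
  set w := (TwoChannel.W).mulVec v with hw
  have h2v : (TwoChannel.W).mulVec w = (2 : ℝ) • v := by
    rw [hw, Matrix.mulVec_mulVec, hWW, Matrix.smul_mulVec, Matrix.one_mulVec]
  have key : dotProduct ((2 : ℝ) • v) (P.mulVec ((2 : ℝ) • v))
      = dotProduct w ((TwoChannel.W.transpose * P * TwoChannel.W).mulVec w) := by
    rw [← h2v, ← Matrix.mulVec_mulVec, ← Matrix.mulVec_mulVec, Matrix.dotProduct_mulVec w, Matrix.vecMul_transpose]
  have lhs : dotProduct ((2 : ℝ) • v) (P.mulVec ((2 : ℝ) • v)) = 4 * dotProduct v (P.mulVec v) := by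
    rw [Matrix.mulVec_smul, smul_dotProduct, dotProduct_smul, smul_eq_mul, smul_eq_mul]
    ring
  have rhs : dotProduct w ((TwoChannel.W.transpose * P * TwoChannel.W).mulVec w)
      = 2 * (dotProduct (w ∘ Sum.inl) (Pp.mulVec (w ∘ Sum.inl)) + dotProduct (w ∘ Sum.inr) (Pm.mulVec (w ∘ Sum.inr))) := by
    rw [hred, Matrix.smul_mulVec, dotProduct_smul, smul_eq_mul, Matrix.fromBlocks_mulVec]
    simp only [Matrix.zero_mulVec, add_zero, zero_add]
    congr 1
    simp only [dotProduct, Fintype.sum_sum_type, Sum.elim_inl, Sum.elim_inr, Function.comp_apply]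
  have h1 := hplus (w ∘ Sum.inl)
  have h2 := hminus (w ∘ Sum.inr)
  nlinarith [key, lhs, rhs, h1, h2]

/-- ★★ **HOLE₂ certificate of a pair from its two CHANNELS** (memo 21 §318/§324, THEOREM H2F's structure): with `A₀ = clusterKer`,
`M = hankel (z₂ − z₁)`, `Λ̃ = capT`: if `A₀ ± M` and `fromBlocks A₀ M M A₀` are invertible, `Λ̃s ≠ 1`, and the EVEN channel
`oneHoleP (A₀ + M) (2Λ̃)` and the ODD channel `oneHoleP (A₀ − M) 0` are both `⪰ 0`, then `DualCert L g z₁ z₂`. [folklore] -/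
theorem dualCert_of_channels (g : ℝ) (z₁ z₂ : Tor L)
    (hp : IsUnit (clusterKer L g + hankel L g (z₂ - z₁)).det) (hm : IsUnit (clusterKer L g - hankel L g (z₂ - z₁)).det)
    (hA : IsUnit (Matrix.fromBlocks (clusterKer L g) (hankel L g (z₂ - z₁)) (hankel L g (z₂ - z₁)) (clusterKer L g)).det)
    (hΛ : capT L g * TwoChannel.svec2
      (Matrix.fromBlocks (clusterKer L g) (hankel L g (z₂ - z₁)) (hankel L g (z₂ - z₁)) (clusterKer L g)) - 1 ≠ 0)
    (hplus : ∀ u : Fin 4 → ℝ,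
      0 ≤ dotProduct u ((TwoChannel.oneHoleP (clusterKer L g + hankel L g (z₂ - z₁)) (2 * capT L g)).mulVec u))
    (hminus : ∀ u : Fin 4 → ℝ,
      0 ≤ dotProduct u ((TwoChannel.oneHoleP (clusterKer L g - hankel L g (z₂ - z₁)) 0).mulVec u)) :
    DualCert L g z₁ z₂ :=
  dualCert_of_hankel L g z₁ z₂ hA hΛ
    (twoHoleP_nonneg_of_channels _ _ _ (clusterKer_isSymm L g) (hankel_isSymm L g _) hp hm hΛ hplus hminus)

end TwoHoleBS

end Summit.HubbardSuperconductivity.HubbardSuperconductivity.Theorems.AnisotropyChord.Transfer.Fibre3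

end
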